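import Summits.Ventures.QEC.Thresholds.PlanarSurfaceCodeThresholds
import Literature.InformationTheory.QuantumCodes.PlanarCodeMatching
import Literature.InformationTheory.QuantumCodes.MatchingDecodersExistence
import HarnessLib

/-!
# Certified planar-surface-code thresholds for MINIMUM-WEIGHT PERFECT MATCHING decoders with a boundary
# (code capacity, both sectors, and `T` noisy rounds)

Venture QEC, `Summits/Ventures/QEC/Thresholds/` (LADDER-QEC rung Q5 «toric/SURFACE + MWPM»; qec-type-09 gen 4, item
09.MWPM; companion of `ToricCodeMWPMThresholds.lean`). The planar surface codes of the tree
(`PlanarSurfaceCodeThresholds.lean`: `planarHX k` / `planarHZ k` = `HGP(H, Hᵀ)` of the repetition matrix, i.e.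
Dennis–Kitaev–Landahl–Preskill's planar codes with a rough and a smooth edge, §3.2) have certified thresholds for
every MINIMUM-WEIGHT decoder family. Practical surface-code decoders match the defects by minimum-weight perfect
matching with a VIRTUAL BOUNDARY NODE (a defect may be matched to the edge). The Literature files prove that this
IS minimum-weight decoding: `MatchingDecodersBoundary.lean` (`isMinWeight_boundaryDecoder` / `_st`: Edmonds–Johnson
on the graph extended by the boundary check `none`, the boundary parity bit fixed by the handshake lemma),
`PlanarCodeMatching.lean` (both planar check matrices have column weight `≤ 2`, hence are graphlike with boundary:
`exists_isGraphlikeVia_planarHX / _planarHZ`), `MatchingDecodersExistence.lean` (matching decoders exist for every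
graph, `exists_isMatchingDecoder_extMetric`). Consequences (all UNCONDITIONAL, tier CERTIFIED (kernel), axioms
standard, 0 facts; each theorem quantifies over EVERY presentation `ι` of the check matrix as graphlike-with-boundary,
EVERY link metric `m`, EVERY matching decoder `D'` of the extended graph — any tie-break, any geodesics — and enters
the minimum-weight theorems only through `Decoder.IsMinWeight`; no new constant):

| theorem | statement (certified LOWER bounds on the threshold) |
|---|---|
| `planar_mwpm_threshold`, `planar_mwpm_accuracyThreshold_gt_0285` | `H_X`-sector, code capacity, every boundary-MWPM family: threshold `≥ p₀(3)`, **`p_c > .0285`** |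
| `planar_mwpm_threshold'` | `H_Z`-sector: threshold `≥ p₀(3)` |
| `planar_phenom_mwpm_threshold`, `planar_phenom_mwpm_accuracyThreshold_gt_0101` | `T(k)` noisy rounds (`q = p`, poly-bounded `T`), SPACE-TIME boundary MWPM: `≥ p₀(5)`, **`p_c > .0101`** |
| `planar_phenom_mwpm_threshold'` | second sector, space-time boundary MWPM: `≥ p₀(5)` |
| `exists_planar_mwpm_family_accuracyThreshold_gt_0285` | non-vacuity: a boundary-MWPM family with certified threshold `> .0285` exists |

## References
* [DennisEtAl2002] E. Dennis, A. Kitaev, A. Landahl, J. Preskill, *Topological quantum memory*, J. Math. Phys. 43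
  (2002) 4452–4505, arXiv:quant-ph/0110143, §3.2 (planar codes), §4.4 p. 18, §5.1 p. 19.
* [KorteVygen2002] B. Korte, J. Vygen, *Combinatorial Optimization*, 2nd ed., Springer (2002), §12.2 Thm 12.9.
* [DumerKovalevPryadko2015] I. Dumer, A. A. Kovalev, L. P. Pryadko, PRL 115 (2015) 050502, Thm 2–3.
-/

namespace Summit.Ventures.QEC.Thresholds

open Filter Topology Finset Matrix
open Literature.InformationTheory.QuantumCodes

/-! ### Code capacity, `H_X`-sector (defects on the `X`-checks, rough edge as boundary) -/

/-- **Planar code-capacity threshold `≥ p₀(3)` for every boundary-MWPM decoder family** (any presentation `ι`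
of `planarHX k` as graphlike with boundary — one exists by `exists_isGraphlikeVia_planarHX` —, any link metric,
tie-break, geodesics) — UNCONDITIONAL, kernel. [cite: DennisEtAl2002, §3.2 and §4.4 p. 18] -/
theorem planar_mwpm_threshold {ι : ∀ k, PlanarQubit k → Sym2 (Option (PlanarCheck k))}
    (hι : ∀ k, IsGraphlikeVia (planarHX k) (ι k)) (m : ∀ k, EdgeMetric (ι k))
    {D' : ∀ k, Decoder (Option (PlanarCheck k) → ZMod 2) (PlanarQubit k → ZMod 2)}
    (hD : ∀ k, IsMatchingDecoder (m k) (D' k)) :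
    IsThresholdLowerBound (planarFailureFamily fun k => boundaryDecoder (D' k)) (thresholdValue 3) :=
  planar_isThresholdLowerBound _ fun k => isMinWeight_boundaryDecoder (hι k) (hD k)

/-- **`p_c^{MWPM} > .0285` for the planar surface codes** (code capacity, `H_X`-sector), every boundary-MWPM
family — UNCONDITIONAL, kernel; a certified LOWER bound on the threshold. [cite: DennisEtAl2002, §3.2 and §4.4 p. 18] -/
theorem planar_mwpm_accuracyThreshold_gt_0285 {ι : ∀ k, PlanarQubit k → Sym2 (Option (PlanarCheck k))}
    (hι : ∀ k, IsGraphlikeVia (planarHX k) (ι k)) (m : ∀ k, EdgeMetric (ι k))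
    {D' : ∀ k, Decoder (Option (PlanarCheck k) → ZMod 2) (PlanarQubit k → ZMod 2)}
    (hD : ∀ k, IsMatchingDecoder (m k) (D' k)) :
    (0.0285 : ℝ) < accuracyThreshold (planarFailureFamily fun k => boundaryDecoder (D' k)) :=
  planar_accuracyThreshold_gt _ fun k => isMinWeight_boundaryDecoder (hι k) (hD k)

/-- **Second sector (`H_Z`-checks, smooth edge as boundary): threshold `≥ p₀(3)` for every boundary-MWPM family**
— UNCONDITIONAL, kernel. [cite: DennisEtAl2002, §3.2 and §4.4 p. 18] -/
theorem planar_mwpm_threshold' {ι : ∀ k, PlanarQubit k → Sym2 (Option (PlanarZCheck k))}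
    (hι : ∀ k, IsGraphlikeVia (planarHZ k) (ι k)) (m : ∀ k, EdgeMetric (ι k))
    {D' : ∀ k, Decoder (Option (PlanarZCheck k) → ZMod 2) (PlanarQubit k → ZMod 2)}
    (hD : ∀ k, IsMatchingDecoder (m k) (D' k)) :
    IsThresholdLowerBound (planarFailureFamily' fun k => boundaryDecoder (D' k)) (thresholdValue 3) :=
  planar_isThresholdLowerBound' _ fun k => isMinWeight_boundaryDecoder (hι k) (hD k)

/-- **Non-vacuity**: there IS a boundary-MWPM family for the planar `H_X`-sector (some presentation, the extended
shortest-chain metric, some tie-break and geodesics), and its certified threshold exceeds `.0285`.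
[cite: DennisEtAl2002, §3.2 and §4.4 p. 18] -/
theorem exists_planar_mwpm_family_accuracyThreshold_gt_0285 :
    ∃ (ι : ∀ k, PlanarQubit k → Sym2 (Option (PlanarCheck k)))
      (D' : ∀ k, Decoder (Option (PlanarCheck k) → ZMod 2) (PlanarQubit k → ZMod 2)),
      (∀ k, IsGraphlikeVia (planarHX k) (ι k)) ∧ (∀ k, IsMatchingDecoder (extMetric (ι k)) (D' k)) ∧
        (0.0285 : ℝ) < accuracyThreshold (planarFailureFamily fun k => boundaryDecoder (D' k)) := by
  choose ι hι using exists_isGraphlikeVia_planarHX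
  choose D' hD using fun k => exists_isMatchingDecoder_extMetric (ι := ι k)
  exact ⟨ι, D', hι, hD, planar_mwpm_accuracyThreshold_gt_0285 hι (fun k => extMetric (ι k)) hD⟩

/-! ### `T` noisy rounds: space-time matching with a boundary -/

/-- **Planar phenomenological threshold `≥ p₀(5)` for every SPACE-TIME boundary-MWPM decoder family** (defects =
syndrome changes of the `T(k)` rounds, matched in the space-time graph extended by the boundary check; any
presentation `ι`, any link metric on the space-time lift `stEndsOf (ι k) (T k)`, tie-break, geodesics; `q = p`,
every polynomially bounded schedule) — UNCONDITIONAL, kernel. [cite: DennisEtAl2002, §5.1 p. 19 (E_min on the space-time lattice)] -/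
theorem planar_phenom_mwpm_threshold {T : ℕ → ℕ} (hT : ToricCode.IsPolyBounded T)
    {ι : ∀ k, PlanarQubit k → Sym2 (Option (PlanarCheck k))} (hι : ∀ k, IsGraphlikeVia (planarHX k) (ι k))
    (m : ∀ k, EdgeMetric (stEndsOf (ι k) (T k)))
    {D' : ∀ k, Decoder (Option (PlanarCheck k × Fin (T k + 1)) → ZMod 2)
      (HistoryLoc (PlanarQubit k) (PlanarCheck k) (T k) → ZMod 2)}
    (hD : ∀ k, IsMatchingDecoder (m k) (D' k)) :
    IsThresholdLowerBound (planarPhenomFailureFamily T fun k => boundaryDecoder (D' k)) (thresholdValue 5) :=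
  planar_phenom_isThresholdLowerBound hT fun k => isMinWeight_boundaryDecoder_st (hι k) (T k) (hD k)

/-- **`p_c^{MWPM} > .0101` under phenomenological noise for the planar surface codes**, every space-time
boundary-MWPM family — UNCONDITIONAL, kernel; a certified LOWER bound. [cite: DennisEtAl2002, §5.1 p. 19 and §5.3] -/
theorem planar_phenom_mwpm_accuracyThreshold_gt_0101 {T : ℕ → ℕ} (hT : ToricCode.IsPolyBounded T)
    {ι : ∀ k, PlanarQubit k → Sym2 (Option (PlanarCheck k))} (hι : ∀ k, IsGraphlikeVia (planarHX k) (ι k))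
    (m : ∀ k, EdgeMetric (stEndsOf (ι k) (T k)))
    {D' : ∀ k, Decoder (Option (PlanarCheck k × Fin (T k + 1)) → ZMod 2)
      (HistoryLoc (PlanarQubit k) (PlanarCheck k) (T k) → ZMod 2)}
    (hD : ∀ k, IsMatchingDecoder (m k) (D' k)) :
    (0.0101 : ℝ) < accuracyThreshold (planarPhenomFailureFamily T fun k => boundaryDecoder (D' k)) :=
  planar_phenom_accuracyThreshold_gt hT fun k => isMinWeight_boundaryDecoder_st (hι k) (T k) (hD k)

/-- **Second sector, `T` noisy rounds: `≥ p₀(5)` for every space-time boundary-MWPM family** — UNCONDITIONAL,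
kernel. [cite: DennisEtAl2002, §5.1 p. 19 and §5.3] -/
theorem planar_phenom_mwpm_threshold' {T : ℕ → ℕ} (hT : ToricCode.IsPolyBounded T)
    {ι : ∀ k, PlanarQubit k → Sym2 (Option (PlanarZCheck k))} (hι : ∀ k, IsGraphlikeVia (planarHZ k) (ι k))
    (m : ∀ k, EdgeMetric (stEndsOf (ι k) (T k)))
    {D' : ∀ k, Decoder (Option (PlanarZCheck k × Fin (T k + 1)) → ZMod 2)
      (HistoryLoc (PlanarQubit k) (PlanarZCheck k) (T k) → ZMod 2)}
    (hD : ∀ k, IsMatchingDecoder (m k) (D' k)) :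
    IsThresholdLowerBound (planarPhenomFailureFamily' T fun k => boundaryDecoder (D' k)) (thresholdValue 5) :=
  planar_phenom_isThresholdLowerBound' hT fun k => isMinWeight_boundaryDecoder_st (hι k) (T k) (hD k)

end Summit.Ventures.QEC.Thresholds
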